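import Summits.HodgeConjecture.HodgeConjecture.Theorems.PadicSemiregularLiftFermatAnchorAssemblyEulerHomDim
import Summits.HodgeConjecture.HodgeConjecture.Theorems.PadicSemiregularLiftFermatAnchorAssemblyEulerProj
import Summits.HodgeConjecture.HodgeConjecture.Theorems.PadicSemiregularLiftFermatAnchorAssemblyEulerHomotopy
import Mathlib.RingTheory.Polynomial.Basic
import Mathlib.LinearAlgebra.FreeModule.Finite.Basic
import Mathlib.RingTheory.Noetherian.Basic

/-!
# The `ℤ`-graded Hom complex of a pair of graded matrix factorizations, VI: Hom-finiteness (line `witt-lift-rigid-mf`)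

Crux `FermatAnchorAssembly` (stmt-HodgeConjecture-14874), stub `stub_eulerBaseChange`; continues
`…EulerHomDim.lean`, `…EulerProj.lean`, `…EulerHomotopy.lean`.

**Theorem (`finite_setOf_homDim_ne_zero`, registered).** For a LAWFUL pair `(M, N)` of `L`-graded matrix
factorizations of `Σ xᵢᵐ` over a field `F` in which `m` is invertible, `Hom(M, N(t)) = 0` for all but
finitely many twists `t`: the set `{t | homDim F L t M N ≠ 0}` is finite.

Proof: the total even cohomology `H = ker dMap / (im hMap ∩ ker dMap)` of the Hom complex is a finitely
generated `F[x]`-module (`F[x]` is Noetherian and the ambient space of pairs of matrices is finite free),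
killed by every `xᵢ^{m−1}` (the Jacobian homotopy, `…EulerHomotopy`), hence FINITE-DIMENSIONAL over `F`;
and the graded pieces `closedSub t / nullSub t` for distinct `t` embed jointly into `H`, because a
cochain of twist `t` that is null-homotopic by an arbitrary homotopy is so by a homotopy of twist `t`
(the bigraded projections, `…EulerProj`). So at most `dim_F H` twists carry a non-zero `homDim`.
All `[folklore]`; no named fact, no `sorry`.
-/

-- `Summit.HodgeConjecture.HodgeConjecture.…` is the tree's mandated summit/problem namespace (single-problem summit).
set_option linter.dupNamespace false

noncomputable section

open Finset Module MvPolynomial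

namespace Summit.HodgeConjecture.HodgeConjecture.Cruxes.FermatAnchorAssembly.WittLiftRigidMf

namespace GMFData

variable {F : Type} [Field F] {ν m : ℕ} {ι₀ ι₁ κ₀ κ₁ : Type} [Fintype ι₀] [Fintype ι₁] [Fintype κ₀]
  [Fintype κ₁] [DecidableEq ι₀] [DecidableEq ι₁] [DecidableEq κ₀] [DecidableEq κ₁]
  {L : AddSubgroup (Fin ν → ZMod m)}

/-- A non-zero `homDim` is witnessed by a closed cochain that is not null-homotopic. [folklore] -/
theorem exists_closed_notMem_null (M : GMF F ν m L ι₀ ι₁) (N : GMF F ν m L κ₀ κ₁) (t : ℤ)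
    (h : homDim F L t M.toGMFData N.toGMFData ≠ 0) :
    ∃ z ∈ closedSub L t M.toGMFData N.toGMFData, z ∉ nullSub L t M.toGMFData N.toGMFData := by
  by_contra hall
  push Not at hall
  apply h
  unfold homDim
  rw [span_closedSet, span_nullSet]
  have htop : (nullSub L t M.toGMFData N.toGMFData).comap
      (closedSub L t M.toGMFData N.toGMFData).subtype = ⊤ := by
    rw [eq_top_iff]
    rintro ⟨z, hz⟩ -
    exact hall z hz
  haveI : Subsingleton (↥(closedSub L t M.toGMFData N.toGMFData) ⧸
      (nullSub L t M.toGMFData N.toGMFData).comap (closedSub L t M.toGMFData N.toGMFData).subtype) :=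
    Submodule.Quotient.subsingleton_iff.mpr htop
  exact Module.finrank_zero_of_subsingleton

omit [DecidableEq ι₀] [DecidableEq ι₁] [DecidableEq κ₀] [DecidableEq κ₁] in
/-- The closed cochains (of all twists) form a finitely generated `F[x]`-module (`F[x]` Noetherian). [folklore] -/
theorem kerDMap_finite (M : GMFData F ν m ι₀ ι₁) (N : GMFData F ν m κ₀ κ₁) :
    Module.Finite (MvPolynomial (Fin ν) F) (LinearMap.ker (dMap M N)) := by
  haveI : IsNoetherian (MvPolynomial (Fin ν) F)
      (Matrix κ₀ ι₀ (MvPolynomial (Fin ν) F) × Matrix κ₁ ι₁ (MvPolynomial (Fin ν) F)) :=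
    isNoetherian_of_isNoetherianRing_of_finite _ _
  infer_instance

/-- **The total even cohomology of the Hom complex is finite-dimensional** when `m` is invertible:
it is finitely generated over `F[x]` and killed by all `xᵢ^{m−1}`. [folklore] -/
theorem cohomology_moduleFinite (M : GMF F ν m L ι₀ ι₁) (N : GMF F ν m L κ₀ κ₁) (hm : IsUnit (m : F)) :
    Module.Finite F (↥(LinearMap.ker (dMap M.toGMFData N.toGMFData)) ⧸
      (LinearMap.range (hMap M.toGMFData N.toGMFData)).comap
        (LinearMap.ker (dMap M.toGMFData N.toGMFData)).subtype) := by
  haveI := kerDMap_finite M.toGMFData N.toGMFData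
  refine moduleFinite_of_X_pow_smul_eq_zero (ν := ν) (m - 1) fun i x ↦ ?_
  obtain ⟨z, rfl⟩ := Submodule.Quotient.mk_surjective _ x
  rw [← Submodule.Quotient.mk_smul, Submodule.Quotient.mk_eq_zero, Submodule.mem_comap,
    Submodule.subtype_apply, Submodule.coe_smul]
  exact X_pow_smul_mem_range M N.toGMFData i hm z.2

/-- **The graded pieces embed jointly into the total cohomology**: for finitely many distinct twists,
classes of closed non-null-homotopic cochains are linearly independent over `F`; hence the number of
twists with `homDim ≠ 0` is at most `dim_F H`. [folklore] -/
theorem card_le_finrank_cohomology (M : GMF F ν m L ι₀ ι₁) (N : GMF F ν m L κ₀ κ₁) (hm : IsUnit (m : F))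
    (T : Finset ℤ) (hT : ∀ t ∈ T, homDim F L t M.toGMFData N.toGMFData ≠ 0) :
    T.card ≤ finrank F (↥(LinearMap.ker (dMap M.toGMFData N.toGMFData)) ⧸
      (LinearMap.range (hMap M.toGMFData N.toGMFData)).comap
        (LinearMap.ker (dMap M.toGMFData N.toGMFData)).subtype) := by
  classical
  haveI := cohomology_moduleFinite M N hm
  set K := LinearMap.ker (dMap M.toGMFData N.toGMFData) with hK
  set Rg := LinearMap.range (hMap M.toGMFData N.toGMFData) with hRg
  -- witnesses
  choose z hz using fun t : T ↦ exists_closed_notMem_null M N t.1 (hT t.1 t.2)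
  have hzK : ∀ t : T, z t ∈ K := fun t ↦ (mem_closedSub.mp (hz t).1).2
  let x : T → K := fun t ↦ ⟨z t, hzK t⟩
  let v : T → K ⧸ Rg.comap K.subtype := fun t ↦ (Rg.comap K.subtype).mkQ (x t)
  have hv : LinearIndependent F v := by
    rw [linearIndependent_iff']
    intro s g hsum t₀ ht₀
    -- the combination is null-homotopic by SOME homotopy
    have h1 : (Rg.comap K.subtype).mkQ (∑ t ∈ s, g t • x t) = 0 := by
      rw [map_sum]
      simpa only [LinearMap.map_smul_of_tower] using hsum
    have h2 : (∑ t ∈ s, g t • x t) ∈ Rg.comap K.subtype := by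
      rw [← Submodule.Quotient.mk_eq_zero, ← Submodule.mkQ_apply]
      exact h1
    rw [Submodule.mem_comap, map_sum] at h2
    simp only [LinearMap.map_smul_of_tower, Submodule.subtype_apply] at h2
    -- h2 : ∑ t ∈ s, g t • z t ∈ Rg
    obtain ⟨w, hw⟩ := LinearMap.mem_range.mp h2
    -- project onto twist t₀
    have hproj : projP L (t₀ : ℤ) M.toGMFData N.toGMFData (∑ t ∈ s, g t • (x t : _)) = g t₀ • z t₀ := by
      rw [map_sum, Finset.sum_eq_single t₀]
      · rw [map_smul, projP_eq_self (hz t₀).1.1]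
      · intro t _ htt
        rw [map_smul, projP_eq_zero_of_ne (hz t).1.1 (fun h ↦ htt (Subtype.ext h)), smul_zero]
      · intro h
        exact absurd ht₀ h
    have hnull : g t₀ • z t₀ ∈ nullSub L (t₀ : ℤ) M.toGMFData N.toGMFData := by
      rw [← hproj, ← hw, ← hMap_projQ, mem_nullSub]
      exact ⟨_, projQ_mem L _ _ _ w, rfl⟩
    by_contra hg
    apply (hz t₀).2
    have : z t₀ = (g t₀)⁻¹ • (g t₀ • z t₀) := by rw [smul_smul, inv_mul_cancel₀ hg, one_smul]
    rw [this]
    exact Submodule.smul_mem _ _ hnull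
  simpa using hv.fintype_card_le_finrank

end GMFData

/-- **Registered sub-goal: Hom-finiteness of the homotopy category of `L`-graded matrix factorizations of
the Fermat form with `m` invertible.** For a lawful pair `(M, N)` over a field `F` with `(m : F)` a unit,
`Hom(M, N(t)) ≠ 0` for only finitely many twists `t`. [folklore] -/
theorem finite_setOf_homDim_ne_zero : ∀ (F : Type) [Field F] (ν m : ℕ) (L : AddSubgroup (Fin ν → ZMod m))
    (ι₀ ι₁ κ₀ κ₁ : Type) [Fintype ι₀] [Fintype ι₁] [Fintype κ₀] [Fintype κ₁] [DecidableEq ι₀]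
    [DecidableEq ι₁] [DecidableEq κ₀] [DecidableEq κ₁] (M : GMF F ν m L ι₀ ι₁) (N : GMF F ν m L κ₀ κ₁),
    IsUnit (m : F) → {t : ℤ | GMFData.homDim F L t M.toGMFData N.toGMFData ≠ 0}.Finite := by
  intro F _ ν m L ι₀ ι₁ κ₀ κ₁ _ _ _ _ _ _ _ _ M N hm
  by_contra hinf
  obtain ⟨T, hTsub, hcard⟩ := Set.Infinite.exists_subset_card_eq hinf
    (Module.finrank F (↥(LinearMap.ker (GMFData.dMap M.toGMFData N.toGMFData)) ⧸
      (LinearMap.range (GMFData.hMap M.toGMFData N.toGMFData)).comap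
        (LinearMap.ker (GMFData.dMap M.toGMFData N.toGMFData)).subtype) + 1)
  have := GMFData.card_le_finrank_cohomology M N hm T fun t ht ↦ hTsub ht
  omega

end Summit.HodgeConjecture.HodgeConjecture.Cruxes.FermatAnchorAssembly.WittLiftRigidMf

end
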